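import Mathlib
import Summits.Ventures.HodgeRepro.Tier4.Target
import Summits.Ventures.HodgeRepro.Tier4.Line3.Defs
import Summits.Ventures.HodgeRepro.Tier4.Line3.DefsLemmas
import Summits.Ventures.HodgeRepro.Tier4.Line3.HeckeEquivarianceLemmas
import Summits.Ventures.HodgeRepro.Tier4.Line3.TorusInvariance
import Summits.Ventures.HodgeRepro.Tier4.Line3.MainClassReps
import Summits.Ventures.HodgeRepro.Tier4.Line3.CoefMajorantWitness
import Summits.Ventures.HodgeRepro.Tier4.Line3.Witness.ThetaDataWitnessCf
import Summits.Ventures.HodgeRepro.Tier4.Line3.LocSScalarObstructionGen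
import Summits.Ventures.HodgeRepro.Tier4.Line3.UnitCopyScaling
import Summits.Ventures.HodgeRepro.Tier4.Line3.UnitCopyTerm
import Summits.Ventures.HodgeRepro.Tier4.Line3.UnitCopyPos

/-!
# Tier4/Line3/UnitCopySphere — the per-slot scalar symmetry ON THE SPHERE of the centre, and the copy's term from it

Blind re-derivation cell `pub-hodge-repro`, Tier 4 «PROVE THE STEP», LINE L3, seat t4-L3-p2 (g2); bus S13561 (the correction of
plan-3 g3's cut S13557).  For a NON-UNIT scalar `β` the natural slot function satisfies `cf j (β • x) · gaussDef x = κ_j(β) ·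
cf j x · gaussDef (β • x)` only where `x` is primitive at the places dividing `N(β)` — on the SPHERE `{t • (g • xm j)}` of the
centre (unitary `g`, norm-one `t`), where the Gram entry is a unit — not for every `x` (`SlotScalarSymmetric` of p679303 is FALSE
there).  This module re-proves the copy structure of p680022 / p680492 / p680774 under the sphere hypothesis:

* `sphere xm j` and `SphereScalarSymmetric D xm j u lam`; the sphere is stable under the unitary Hecke representatives
  (`mulVec_mem_sphere`) and contains every slot of every representative of the main orbit (`rep_mem_sphere`);
* `heckeAct_smul_of_sphere`, `coefQ_smul_of_sphere` (at tuples with every slot on its sphere), `summand_scaleLine_of_sphere`;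
* **`term_scaleLine_eq_of_sphere`** and **`term_scaleLine_eq_of_sphere_of_pos`**: the term of the copy `ε • xm` of the main
  orbit is `Λ(ε) · T` (resp. `Λ(ε) · gaussRatio ε xm · T′`) with `T, T′ ≥ 0`, exactly as in p680492 / p680774, now under the
  honest hypothesis — so x2's family-sum identity (S13557 cut (2)) can be stated for every family member.

Nothing here says anything about the status of the Hodge conjecture for CM abelian varieties, which is NOT proved
(HC_CM is NOT proved by anyone in this repository).
-/

set_option autoImplicit false

noncomputable section

namespace Summit.Ventures.HodgeRepro.Tier4.Line3

open Summit.Ventures.HodgeRepro.Tier4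
open Matrix NumberField MeasureTheory
open scoped ComplexConjugate

namespace T4Data

variable (X : T4Data)

/-! ### 1. The sphere of a slot of the centre -/

/-- The sphere of slot `j` of the centre: the `U(H)(E′) × E′¹`-orbit of `xm j`. -/
def sphere (xm : X.Tuple) (j : Fin 4) : Set (Fin 3 → X.E) :=
  {v | ∃ (g : Matrix (Fin 3) (Fin 3) X.E) (t : X.E), IsUnitaryOf X.c X.H g ∧ X.c t * t = 1 ∧ v = t • (g *ᵥ xm j)}

/-- The sphere is stable under the unitary group. -/
theorem mulVec_mem_sphere (xm : X.Tuple) (j : Fin 4) {r : Matrix (Fin 3) (Fin 3) X.E} (hr : IsUnitaryOf X.c X.H r)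
    {v : Fin 3 → X.E} (hv : v ∈ X.sphere xm j) : r *ᵥ v ∈ X.sphere xm j := by
  obtain ⟨g, t, hg, ht, rfl⟩ := hv
  exact ⟨r * g, t, HeckeEquivariance.isUnitaryOf_mul X.c X.H hr hg, ht, by rw [Matrix.mulVec_smul, Matrix.mulVec_mulVec]⟩

/-- Every slot of every representative of the main orbit lies on its sphere. -/
theorem rep_mem_sphere (xm : X.Tuple) {w : X.LineTuple} (hw : X.orbitOf w = X.orbitOf (X.lines xm)) (j : Fin 4) :
    X.rep w j ∈ X.sphere xm j := by
  obtain ⟨g, hg, rfl⟩ := X.exists_unitary_of_orbitOf_eq xm hw.symm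
  obtain ⟨t, ht, hrep⟩ := X.exists_torus_rep_lines (fun j => g *ᵥ xm j)
  exact ⟨g, t j, hg, ht j, by rw [hrep]⟩

/-- **SCALAR SYMMETRY OF SLOT `j` ON THE SPHERE OF THE CENTRE, up to a constant** — the honest per-slot clause for a scalar
`u` that is not a unit (the natural slot function satisfies it with `lam = κ_j(u)`, the geometric sums at the places dividing
`N(u)`, because the Gram entry of a sphere point is a unit there). -/
def SphereScalarSymmetric (D : X.ThetaData) (xm : X.Tuple) (j : Fin 4) (u : X.E) (lam : ℂ) : Prop :=
  ∀ v ∈ X.sphere xm j, D.cf j (u • v) * (X.gaussDef v : ℂ) = lam * (D.cf j v * (X.gaussDef (u • v) : ℂ))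

/-- The global per-slot symmetry implies the sphere one. -/
theorem sphereScalarSymmetric_of_slotScalarSymmetric (D : X.ThetaData) (xm : X.Tuple) {j : Fin 4} {u : X.E} {lam : ℂ}
    (hu : X.SlotScalarSymmetric D j u lam) : X.SphereScalarSymmetric D xm j u lam := fun v _ => hu v

/-! ### 2. Hecke translates, coefficients and summands on the sphere -/

/-- Every Hecke translate of every level inherits the sphere symmetry with the same constant. -/
theorem heckeAct_smul_of_sphere (D : X.ThetaData) {xm : X.Tuple} {j : Fin 4} {u : X.E} {lam : ℂ}
    (hu : X.SphereScalarSymmetric D xm j u lam) (K : X.Level) {h : HeckeElement X.E} (hh : h.IsFor X.c X.H K.1)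
    {v : Fin 3 → X.E} (hv : v ∈ X.sphere xm j) :
    X.heckeAct h (D.cf j) (u • v) * (X.gaussDef v : ℂ) = lam * (X.heckeAct h (D.cf j) v * (X.gaussDef (u • v) : ℂ)) := by
  unfold T4Data.heckeAct
  rw [← List.sum_map_mul_right, ← List.sum_map_mul_right, ← List.sum_map_mul_left]
  congr 1
  refine List.map_congr_left fun t ht => ?_
  rw [smul_mul_assoc, smul_mul_assoc, Finset.sum_mul, Finset.sum_mul, mul_smul_comm, Finset.mul_sum]
  congr 1
  refine Finset.sum_congr rfl fun r hr => ?_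
  have hru : IsUnitaryOf X.c X.H r := HeckeEquivariance.isUnitaryOf_of_isFor X K hh ht hr
  rw [Matrix.mulVec_smul, ← X.gaussDef_mulVec_of_unitary hru v, hu _ (X.mulVec_mem_sphere xm j hru hv),
    ← Matrix.mulVec_smul, X.gaussDef_mulVec_of_unitary hru]

/-- **THE COEFFICIENT AT A PER-SLOT SCALAR COPY OF A TUPLE ON THE SPHERES**. -/
theorem coefQ_smul_of_sphere (D : X.ThetaData) {xm : X.Tuple} {ε : Fin 4 → X.E} {lam : Fin 4 → ℂ}
    (hu : ∀ j, X.SphereScalarSymmetric D xm j (ε j) (lam j)) {K : X.Level} (γ : X.Tr K) {x : X.Tuple}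
    (hx : ∀ j, x j ∈ X.sphere xm j) :
    X.coefQ D.cf γ (fun j => ε j • x j) =
      lam 0 * lam 1 * conj (lam 2 * lam 3) * ((X.gaussRatio ε x : ℂ) * X.coefQ D.cf γ x) := by
  have hg : ∀ j, (X.gaussDef (x j) : ℂ) ≠ 0 := fun j => Complex.ofReal_ne_zero.2 (X.gaussDef_pos _).ne'
  have key : X.coefQ D.cf γ (fun j => ε j • x j) * ∏ j, (X.gaussDef (x j) : ℂ) =
      lam 0 * lam 1 * conj (lam 2 * lam 3) * (X.coefQ D.cf γ x * ∏ j, (X.gaussDef (ε j • x j) : ℂ)) := by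
    unfold T4Data.coefQ
    rw [Finsupp.sum_mul, Finsupp.sum_mul, Finsupp.mul_sum]
    refine Finsupp.sum_congr fun h _ => ?_
    simp only [Fin.prod_univ_four]
    exact quad_transport_lam (X.heckeAct_smul_of_sphere D (hu 0) K (h.2 (X.slot 0)) (hx 0))
      (X.heckeAct_smul_of_sphere D (hu 1) K (h.2 (X.slot 1)) (hx 1))
      (X.heckeAct_smul_of_sphere D (hu 2) K (h.2 (X.slot 2)) (hx 2))
      (X.heckeAct_smul_of_sphere D (hu 3) K (h.2 (X.slot 3)) (hx 3))
  have hprod : (∏ j, (X.gaussDef (x j) : ℂ)) ≠ 0 := Finset.prod_ne_zero_iff.2 fun j _ => hg j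
  have hratio : (X.gaussRatio ε x : ℂ) = (∏ j, (X.gaussDef (ε j • x j) : ℂ)) / ∏ j, (X.gaussDef (x j) : ℂ) := by
    unfold gaussRatio
    push_cast
    rw [Finset.prod_div_distrib]
  rw [eq_div_of_mul_eq hprod key, hratio]
  ring

/-- The summand at a scaled representative of the main orbit, through the sphere symmetries. -/
theorem summand_scaleLine_of_sphere (D : X.ThetaData) {xm : X.Tuple} {ε : Fin 4 → X.E} {lam : Fin 4 → ℂ}
    (hu : ∀ j, X.SphereScalarSymmetric D xm j (ε j) (lam j)) {K : X.Level} (γ : X.Tr K) {w : X.LineTuple}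
    (hw : X.orbitOf w = X.orbitOf (X.lines xm)) (z : Fin 2 → ℂ) :
    X.summand D.Φ D.cf γ (X.scaleLine ε w) z =
      lam 0 * lam 1 * conj (lam 2 * lam 3) *
        (((X.gaussRatio ε (X.rep w) * X.kernelScale ε (X.rep w) z : ℝ) : ℂ) * X.summand D.Φ D.cf γ w z) := by
  rw [X.summand_eq_of_lines_eq D.Φ D.cf D.weight γ (w := X.scaleLine ε w) (x := fun j => ε j • X.rep w j) rfl z,
    X.coefQ_smul_of_sphere D hu γ (fun j => X.rep_mem_sphere xm hw j), X.kernel_smul_family D.Φ ε (X.rep w) z]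
  unfold T4Data.summand
  push_cast
  ring

/-! ### 3. The term of the copy -/

/-- **THE TERM AT A PER-SLOT SCALAR COPY OF A POSITIVE ORBIT, UNDER THE SPHERE SYMMETRIES**: the phase `Λ(ε)` times a
non-negative real. -/
theorem term_scaleLine_eq_of_sphere (D : X.ThetaData) {ε : Fin 4 → X.E} (hε : ∀ j, ε j ≠ 0) {lam : Fin 4 → ℂ}
    (K : X.Level) (γ : X.Tr K) (xm : X.Tuple) (hu : ∀ j, X.SphereScalarSymmetric D xm j (ε j) (lam j))
    (hpos : ∀ w : X.LineTuple, X.orbitOf w = X.orbitOf (X.lines xm) → ∀ z : Fin 2 → ℂ,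
      (X.summand D.Φ D.cf γ w z).im = 0 ∧ 0 ≤ (X.summand D.Φ D.cf γ w z).re) :
    ∃ T : ℝ, 0 ≤ T ∧
      X.term D.Φ D.cf K γ (X.orbitOf (X.lines fun j => ε j • xm j)) = lam 0 * lam 1 * conj (lam 2 * lam 3) * T := by
  classical
  choose r hr0 hr using fun (w : {w : X.LineTuple // X.orbitOf w = X.orbitOf (X.lines xm)}) (z : Fin 2 → ℂ) =>
    exists_nonneg_ofReal (hpos w.1 w.2 z)
  set ρ : {w : X.LineTuple // X.orbitOf w = X.orbitOf (X.lines xm)} → (Fin 2 → ℂ) → ℝ :=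
    fun w z => X.gaussRatio ε (X.rep w.1) * X.kernelScale ε (X.rep w.1) z * r w z with hρ
  have hρ0 : ∀ w z, 0 ≤ ρ w z := fun w z =>
    mul_nonneg (X.gaussRatio_mul_kernelScale_nonneg ε (X.rep w.1) z) (hr0 w z)
  refine ⟨∫ z in X.domain K, ∑' w, ρ w z, integral_nonneg fun z => tsum_nonneg fun w => hρ0 w z, ?_⟩
  unfold T4Data.term
  rw [show (fun z => ∑' w : {w : X.LineTuple // X.orbitOf w = X.orbitOf (X.lines fun j => ε j • xm j)},
      X.summand D.Φ D.cf γ w.1 z) = fun z => lam 0 * lam 1 * conj (lam 2 * lam 3) * ((∑' w, ρ w z : ℝ) : ℂ) from ?_]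
  · rw [integral_const_mul, integral_complex_ofReal]
  funext z
  rw [← (X.fibreEquiv ε hε xm).tsum_eq, Complex.ofReal_tsum, ← tsum_mul_left]
  refine tsum_congr fun w => ?_
  show X.summand D.Φ D.cf γ (X.scaleLine ε w.1) z = _
  rw [X.summand_scaleLine_of_sphere D hu γ w.2 z, hr w z, hρ]
  push_cast
  ring

/-- **THE TERM OF THE COPY FROM `pos` AT THE CLASS REPRESENTATIVES, UNDER THE SPHERE SYMMETRIES**: `Λ(ε)` times the Gaussian
ratio of the centre times a non-negative real. -/
theorem term_scaleLine_eq_of_sphere_of_pos (D : X.ThetaData) {ε : Fin 4 → X.E} (hε : ∀ j, ε j ≠ 0) {lam : Fin 4 → ℂ}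
    (K : X.Level) (γ : X.Tr K) (xm : X.Tuple) (hu : ∀ j, X.SphereScalarSymmetric D xm j (ε j) (lam j))
    (h02 : xm 2 = xm 0) (h13 : xm 3 = xm 1)
    (hpos : ∀ c : X.MainClass K xm,
      (X.coefQ D.cf γ (X.mainRep K xm c)).im = 0 ∧ 0 ≤ (X.coefQ D.cf γ (X.mainRep K xm c)).re) :
    ∃ T' : ℝ, 0 ≤ T' ∧ X.term D.Φ D.cf K γ (X.orbitOf (X.lines fun j => ε j • xm j)) =
      lam 0 * lam 1 * conj (lam 2 * lam 3) * ((X.gaussRatio ε xm : ℝ) : ℂ) * T' := by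
  obtain ⟨T, hT, hterm⟩ := X.term_scaleLine_eq_of_sphere D hε K γ xm hu
    (fun w hw z => X.summand_nonneg_of_pos D γ xm h02 h13 hpos hw z)
  refine ⟨T / X.gaussRatio ε xm, div_nonneg hT (X.gaussRatio_pos ε xm).le, ?_⟩
  rw [hterm]
  have hR : (X.gaussRatio ε xm : ℂ) ≠ 0 := Complex.ofReal_ne_zero.2 (X.gaussRatio_pos ε xm).ne'
  push_cast
  field_simp

end T4Data

end Summit.Ventures.HodgeRepro.Tier4.Line3

end
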